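import Literature.Geometry.Lorentzian.HonestNearKerrLeaf
import Summits.FinalStateConjecture.FinalStateConjecture.Statement
import HarnessLib

/-!
# The RE-TYPED crux `Capture` over honest leaves, and the glue `Capture → HonestCapture`
# (crux stmt-FinalStateConjecture-10115; routes `BartnikGapSettling` / `QuietWindowCapture`)

For the tenure planners of the two routes (crux dossier
`Summits/FinalStateConjecture/FinalStateConjecture/Cruxes/Capture/NOTES.md`, L28–L30).  Five lead seats
(`Lines/Sketch`, `Lines/dilated_leaves_virial_certificate`, `Lines/inflow_ledger_open_system`) found that
the crux AS TYPED — stated over the inlined block of `CauchyDevelopment.IsNearKerrLeaf` — carries an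
IDLE hypothesis: phantom labels (`NearKerrLeafMinkowskiFakeHoles`), topological overlaps (NOTES L8),
the DODGE (`NearKerrLeafMinkowski{Dodge,Boosted,BoostedDodge}`, `stub_minkowskiDodgeLeaves` p123910) and
non-achronal sheets (`Minkowski.exists_isNearKerrLeaf_not_achronal`) make `0`-hole leaves available
beyond every `J⁻(K)` in every complete-`𝓘⁺` asymptotically flat development (paper), so that `Capture`
is, on paper, the unconditional settling statement.  The repaired predicate
`CauchyDevelopment.IsHonestNearKerrLeaf` (`Literature/Geometry/Lorentzian/HonestNearKerrLeaf.lean`,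
p124187: the typed block + `2Mᵢ ≤ Rᵢ` + slab-to-slab overlaps + flat-frame tube separation +
achronality; anti-vacuity `Minkowski.isHonestNearKerrLeaf_hyperboloid`) removes all four records.

This file gives the planners the re-typed crux text as ONE kernel-checked `Prop`, `HonestCapture` — the
body of `Theses.BartnikGapSettling.Capture` (= `Theses.QuietWindowCapture.Capture`) with the inlined
leaf block replaced by `𝒟.toCauchyDevelopment.IsHonestNearKerrLeaf k ε N M a S`, everything else
verbatim — and the pre-proved glue `honestCapture_of_capture : (body of Capture, verbatim) →
HonestCapture` (honest leaves are typed leaves, `IsHonestNearKerrLeaf.isNearKerrLeaf`, and the inlined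
block IS `IsNearKerrLeaf` by `δ`-unfolding): re-typing WEAKENS the crux (makes it closer to provable and
to the routes' intent); the converse is not available (that is the point).  Theses-free (the hypothesis is
the route decl's body inlined, so the file can be imported by any future closer).

References: DHRT arXiv:2104.08222, §1 (chart/deviation vocabulary); O'Neill 1983, Ch. 14, p. 413
(achronal sets). [DafermosHolzegelRodnianskiTaylor2021] [ONeillSemiRiemannian1983]
-/

noncomputable section

-- the doubled `FinalStateConjecture` path component is the summit/problem naming scheme
set_option linter.dupNamespace false

namespace Summit.FinalStateConjecture.FinalStateConjecture.Theorems.BartnikGapSettling.Capture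

open Set Filter Function Topology
open scoped Manifold ContDiff ENNReal Topology
open Literature.Geometry.Lorentzian

/-- **The crux `Capture` RE-TYPED over honest leaves** (proposal to the planners, as a closed `Prop`):
the body of `Summit.FinalStateConjecture.FinalStateConjecture.Theses.BartnikGapSettling.Capture` verbatim,
except that the inlined twenty-clause leaf block is replaced by
`𝒟.toCauchyDevelopment.IsHonestNearKerrLeaf k ε N M a S` (`HonestNearKerrLeaf.lean`, p124187: the same
block plus thick honest discs `2Mᵢ ≤ Rᵢ`, slab-to-slab overlaps, flat-frame tube separation and
achronality of `S`).  With honest leaves the hypothesis is informative again: every label charts a real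
hole (`2M ≤ R`), the certified pieces chart the same sets, and the sheet is an entire achronal
hypersurface that cannot be parked away from a bounded region.  An OPEN statement (crux-grade: it
contains sub-extremal Kerr stability fed by honest leaves and multi-Kerr capture), recorded here as the
planners' candidate item text, not as a fact (DHRT arXiv:2104.08222, §1 for the vocabulary; O'Neill
1983, Ch. 14, p. 413 for achronal sets). [conjecture] [folklore] -/
def HonestCapture : Prop :=
  ∀ (X : Type) [TopologicalSpace X] [ChartedSpace E3 X] [IsManifold (𝓡 3) ((⊤ : ℕ∞) : WithTop ℕ∞) X] [T2Space X] [SecondCountableTopology X] [ConnectedSpace X], ∀ D ∈ admissibleVacuumData X, ∀ 𝒟 : VacuumCauchyDevelopment D, 𝒟.IsMaximal → Summit.FinalStateConjecture.HasCompleteNullInfinity 𝒟.toCauchyDevelopment → (∃ (N₀ : ℕ) (m₀ χ : ℝ) (k₁ : ℕ) (ε₁ : ENNReal), 0 < m₀ ∧ χ < 1 ∧ 0 < ε₁ ∧ ∀ (k : ℕ) (ε : ENNReal), 0 < ε → ∀ K : Set 𝒟.carrier, IsCompact K → ∃ (N : ℕ) (M a : Fin N → ℝ) (S : Set 𝒟.carrier),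 N ≤ N₀ ∧ (∀ i, m₀ ≤ M i ∧ M i ≤ m₀⁻¹) ∧ Disjoint S (𝒟.metric.causalPast 𝒟.timeOrientation K) ∧ 𝒟.toCauchyDevelopment.IsHonestNearKerrLeaf k ε N M a S ∧ (k₁ ≤ k → ε ≤ ε₁ → ∀ i, |a i| ≤ χ * M i)) → (∃ (O : Set 𝒟.carrier) (d : FinalStateDecomposition 𝒟.toSpacetime O 2), (∀ i, Kerr.IsSubextremal (d.mass i) (d.spin i)) ∧ O = Summit.FinalStateConjecture.exteriorOf 𝒟.toCauchyDevelopment d.charted ∧ Summit.FinalStateConjecture.HasExhaustiveCharts d)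

/-- **Glue: the typed crux implies the re-typed one.**  Hypothesis = the body of
`Theses.BartnikGapSettling.Capture` VERBATIM (so that it `δ`-unfolds to the route decl; Theses-free);
conclusion = `HonestCapture`.  Proof: an honest leaf is a typed leaf with the same labels and the same
set (`IsHonestNearKerrLeaf.isNearKerrLeaf`), and the inlined block of the route decl is
`CauchyDevelopment.IsNearKerrLeaf` up to unfolding `starBackground` / `hypBackground` / `exteriorOf`.
[cite: DafermosHolzegelRodnianskiTaylor2021, §1] -/
theorem honestCapture_of_capture :
    (∀ (X : Type) [TopologicalSpace X] [ChartedSpace E3 X] [IsManifold (𝓡 3) ((⊤ : ℕ∞) : WithTop ℕ∞) X] [T2Space X] [SecondCountableTopology X] [ConnectedSpace X], ∀ D ∈ admissibleVacuumData X, ∀ 𝒟 : VacuumCauchyDevelopment D, 𝒟.IsMaximal → Summit.FinalStateConjecture.HasCompleteNullInfinity 𝒟.toCauchyDevelopment → (∃ (N₀ : ℕ) (m₀ χ : ℝ) (k₁ : ℕ) (ε₁ : ENNReal), 0 < m₀ ∧ χ < 1 ∧ 0 < ε₁ ∧ ∀ (k : ℕ) (ε : ENNReal), 0 < ε → ∀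 K : Set 𝒟.carrier, IsCompact K → ∃ (N : ℕ) (M a : Fin N → ℝ) (S : Set 𝒟.carrier), N ≤ N₀ ∧ (∀ i, m₀ ≤ M i ∧ M i ≤ m₀⁻¹) ∧ Disjoint S (𝒟.metric.causalPast 𝒟.timeOrientation K) ∧ (∃ (R ρ : Fin N → ℝ) (mo : Fin N → lorentzGroup × E4) (r : Fin N → E4 → ℝ) (B : Fin N → ModelBackground) (U₀ : TopologicalSpace.Opens E4) (B₀ : ModelBackground) (Ψ : ∀ i, (B i).domain → 𝒟.carrier) (Ψ₀ : B₀.domain → 𝒟.carrier) (L W : ∀ i, Set (B i).domain) (L₀ W₀ : Set B₀.domain), (∀ i, r i = fun x => Kerr.radius (a i) (poincareInv (mo i).1 (mo i).2 x)) ∧ (∀ i, B i = (⟨⟨poincareInv (mo i).1 (mo i).2 ⁻¹' (Kerr.region (a i) (M i) : Set E4), (Kerr.region (a i) (M i)).isOpen.preimage (continuous_poincareInv (mo i).1 (mo i).2)⟩, boostedKerrBilin (mo i).1 (mo i).2 (M i) (a i), fun x => poincareInv (mo i).1 (mo i).2 x 0, r i⟩ : ModelBackground)) ∧ B₀ = (⟨U₀,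 fun _ => Minkowski.bilin, fun x => x 0 - Real.sqrt (1 + E4.spatialNorm x ^ 2), E4.spatialNorm⟩ : ModelBackground) ∧ (∀ i, L i = {x | -1 < (B i).time x.1 ∧ (B i).time x.1 < 1 ∧ (B i).radius x.1 < R i + 1} ∧ W i = {x | 0 < (B i).time x.1 ∧ (B i).time x.1 < 1 ∧ (B i).radius x.1 ≤ R i}) ∧ L₀ = {x | -1 < B₀.time x.1 ∧ B₀.time x.1 < 1} ∧ W₀ = {x | 0 < B₀.time x.1 ∧ B₀.time x.1 < 1} ∧ (∀ i, 0 < M i ∧ |a i| ≤ M i ∧ 0 < ρ i ∧ ρ i < R i) ∧ {x : E4 | -1 < x 0 - Real.sqrt (1 + E4.spatialNorm x ^ 2) ∧ ∀ i, ρ i < r i x} ⊆ (U₀ : Set E4) ∧ (∀ i, ContMDiffOn 𝓘(ℝ, E4) (𝓡 4) ((⊤ : ℕ∞) : WithTop ℕ∞) (Ψ i) (L i) ∧ Topology.IsOpenEmbedding ((L i).restrict (Ψ i)) ∧ Ψ i '' L i ⊆ 𝒟.metric.causalFuture 𝒟.timeOrientation (Set.range 𝒟.embed)) ∧ ContMDiffOn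 𝓘(ℝ, E4) (𝓡 4) ((⊤ : ℕ∞) : WithTop ℕ∞) Ψ₀ L₀ ∧ Topology.IsOpenEmbedding (L₀.restrict Ψ₀) ∧ Ψ₀ '' L₀ ⊆ 𝒟.metric.causalFuture 𝒟.timeOrientation (Set.range 𝒟.embed) ∧ (∀ i, 𝒟.toSpacetime.truncDeviationCk (B i) (Ψ i) k (R i) 0 ≤ ε) ∧ 𝒟.toSpacetime.deviationCk B₀ Ψ₀ k 0 ≤ ε ∧ Pairwise (Function.onFun Disjoint fun i => Ψ i '' {x | x ∈ L i ∧ (B i).radius x.1 ≤ R i}) ∧ (∀ i, Ψ i '' {x | (B i).time x.1 = 0 ∧ ρ i < (B i).radius x.1 ∧ (B i).radius x.1 ≤ R i} ⊆ Ψ₀ '' L₀) ∧ (∀ i, Ψ₀ '' {x | B₀.time x.1 = 0 ∧ ρ i < r i x.1 ∧ r i x.1 < R i} ⊆ Ψ i '' L i) ∧ S = Ψ₀ '' B₀.timeSlab 0 ∪ ⋃ i, Ψ i '' (B i).truncTimeSlab (R i) 0 ∧ Ψ₀ '' W₀ ∪ ⋃ i, Ψ i '' W i ⊆ 𝒟.metric.chronologicalFuture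 𝒟.timeOrientation S ∧ Summit.FinalStateConjecture.exteriorOf 𝒟.toCauchyDevelopment (Ψ₀ '' W₀ ∪ ⋃ i, Ψ i '' W i) \ (Ψ₀ '' W₀ ∪ ⋃ i, Ψ i '' W i) ⊆ 𝒟.metric.causalPast 𝒟.timeOrientation S) ∧ (k₁ ≤ k → ε ≤ ε₁ → ∀ i, |a i| ≤ χ * M i)) → (∃ (O : Set 𝒟.carrier) (d : FinalStateDecomposition 𝒟.toSpacetime O 2), (∀ i, Kerr.IsSubextremal (d.mass i) (d.spin i)) ∧ O = Summit.FinalStateConjecture.exteriorOf 𝒟.toCauchyDevelopment d.charted ∧ Summit.FinalStateConjecture.HasExhaustiveCharts d)) →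
      HonestCapture := by
  intro hC X _ _ _ _ _ _ D hD 𝒟 hmax hCNI hyp
  obtain ⟨N₀, m₀, χ, k₁, ε₁, hm₀, hχ, hε₁, H⟩ := hyp
  refine hC X D hD 𝒟 hmax hCNI ⟨N₀, m₀, χ, k₁, ε₁, hm₀, hχ, hε₁, fun k ε hε K hK ↦ ?_⟩
  obtain ⟨N, M, a, S, hN, hwin, hdisj, hleaf, hmargin⟩ := H k ε hε K hK
  exact ⟨N, M, a, S, hN, hwin, hdisj, hleaf.isNearKerrLeaf, hmargin⟩

end Summit.FinalStateConjecture.FinalStateConjecture.Theorems.BartnikGapSettling.Capture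

end
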